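import Mathlib
import Summits.Ventures.PercRepro2.SwOutCrossGenProdDefs

/-!
# The product of two dropped components at one junction: the inequality (blind cell PercRepro2,
night-4 g24, 2026-08-28; proofs/NIGHT4-G24.md §11)

The proof of the one-extra-vertex theorem with the single vertex replaced by a whole component
`F₂ : FibreDataBit`: at the CORE points `c` of `F₂` the first cube's inequality applies at frozen
`c` (`card_frozen_leP`, with the sliced up-sets), and the core points of `F₂` are then paired
`c ↔ flip c` at a fixed point of the first cube (`card_pairP_le`: the lower core point has the
better label and the smaller atom set — `pair_label`, `pair_red`); the NON-CORE points of `F₂`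
live on the slabs and are injected through `theta₁ × psi₂` (`card_nc_leP`).
**`ineq_prod`**: `Ineq F₁ ι → Ineq (F₁.prod F₂) ι`.
-/

namespace Summit.Ventures.PercRepro2

namespace CrossArm

section Lemmas

variable {W₁ A₁ L₁ W₂ A₂ L₂ : Type*} {ι : Type*} (F₁ : FibreIter W₁ A₁ L₁) (F₂ : FibreDataBit W₂ A₂ L₂)

/-- The blue atoms are the frozen blue set at the flipped fibre point. -/
lemma EBP_eq_EBpreP (x : PtP W₁ W₂ ι) : EBP F₁ F₂ x = EBpreP F₁ F₂ (F₂.flip x.2.2) x := by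
  simp only [EBP, ERP, flipP, EBpreP, EBI, flipI, redUG_flipAll]

/-- The frozen blue set is monotone in the atoms of the fibre point. -/
lemma EBpreP_mono {c c' : W₂} (h : ∀ a, F₂.red c a = true → F₂.red c' a = true) (x : PtP W₁ W₂ ι) :
    EBpreP F₁ F₂ c x ⊆ EBpreP F₁ F₂ c' x := by
  rintro b (hb | ⟨a, rfl, hs, ha⟩)
  · exact Or.inl hb
  · exact Or.inr ⟨a, rfl, hs, h a ha⟩

/-- The slice of an up-set of types is an up-set of the first cube. -/
lemma isUpI_sliceTP {𝒯 : Set (TypP L₁ L₂ ι)} (h𝒯 : IsUpP F₁ F₂ 𝒯) (l : L₂) :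
    IsUpI F₁ (sliceTP 𝒯 l) := by
  intro t ht t' hle
  exact h𝒯 _ ht (t'.1, t'.2, l) ⟨hle.1, hle.2, F₂.betterL_refl l⟩

/-- The slice of an up-set of atom sets is an up-set. -/
lemma isUpperSet_sliceEP {𝓔 : Set (Set (AtomPr A₁ A₂ ι))} (h𝓔 : IsUpperSet 𝓔) (c : W₂) :
    IsUpperSet (sliceEP F₂ 𝓔 c) := by
  intro S S' hSS hS
  refine h𝓔 ?_ hS
  rintro b (hb | ⟨a, rfl, hu, ha⟩)
  · exact Or.inl (Set.image_mono hSS hb)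
  · exact Or.inr ⟨a, rfl, hSS hu, ha⟩

/-- At a core point of the second component the leak is the first cube's. -/
lemma leakP_core_iff {x : PtP W₁ W₂ ι} (hc : F₂.core x.2.2 = true) :
    LeakP F₁ F₂ x ↔ LeakI F₁ (x.1, x.2.1) := by
  constructor
  · rintro (h | ⟨-, h⟩ | ⟨-, h⟩)
    · exact h
    · rw [F₂.leakR_core _ hc] at h; exact Bool.noConfusion h
    · rw [F₂.leakR_flip_core _ hc] at h; exact Bool.noConfusion h
  · exact Or.inl

/-- The red atoms in the sliced form. -/
lemma ERP_mem_iff {𝓔 : Set (Set (AtomPr A₁ A₂ ι))} {x : PtP W₁ W₂ ι} {c : W₂} (hc : x.2.2 = c) :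
    ERP F₁ F₂ x ∈ 𝓔 ↔ ERI F₁ (x.1, x.2.1) ∈ sliceEP F₂ 𝓔 c := by
  simp only [ERP, sliceEP, Set.mem_setOf_eq, hc, uAtomG_mem_ERI]

/-- The frozen blue set in the sliced form. -/
lemma EBpreP_mem_iff {𝓔 : Set (Set (AtomPr A₁ A₂ ι))} {x : PtP W₁ W₂ ι} (c : W₂) :
    EBpreP F₁ F₂ c x ∈ 𝓔 ↔ EBI F₁ (x.1, x.2.1) ∈ sliceEP F₂ 𝓔 c := by
  simp only [EBpreP, sliceEP, Set.mem_setOf_eq, uAtomG_mem_EBI]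

variable [Fintype ι] [DecidableEq ι] [Fintype W₁] [DecidableEq W₁] [Fintype W₂] [DecidableEq W₂]

open scoped Classical

omit [DecidableEq W₁] [DecidableEq W₂] in
/-- Membership in `QP`. -/
lemma mem_QP {𝒯 : Set (TypP L₁ L₂ ι)} {x : PtP W₁ W₂ ι} :
    x ∈ QP F₁ F₂ 𝒯 ↔ ¬ LeakP F₁ F₂ x ∧ typP F₁ F₂ x ∈ 𝒯 := by
  simp only [QP, Finset.mem_filter, Finset.mem_univ, true_and]

omit [DecidableEq W₁] in
/-- **Step 1, the frozen inequality at a core point `c` of the second component.** -/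
lemma card_frozen_leP (hineq : Ineq F₁ (ι := ι)) {𝒯 : Set (TypP L₁ L₂ ι)} (h𝒯 : IsUpP F₁ F₂ 𝒯)
    {𝓔 : Set (Set (AtomPr A₁ A₂ ι))} (h𝓔 : IsUpperSet 𝓔) (c : W₂) (hc : F₂.core c = true) :
    ((QP F₁ F₂ 𝒯).filter fun x => x.2.2 = c ∧ ERP F₁ F₂ x ∈ 𝓔).card ≤
      ((QP F₁ F₂ 𝒯).filter fun x => x.2.2 = c ∧ EBpreP F₁ F₂ c x ∈ 𝓔).card := by
  have key := hineq _ _ (isUpI_sliceTP F₁ F₂ h𝒯 (F₂.label c)) (isUpperSet_sliceEP F₂ h𝓔 c)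
  have e1 : ((QP F₁ F₂ 𝒯).filter fun x => x.2.2 = c ∧ ERP F₁ F₂ x ∈ 𝓔).card =
      ((QI F₁ (sliceTP 𝒯 (F₂.label c))).filter fun q => ERI F₁ q ∈ sliceEP F₂ 𝓔 c).card := by
    refine Finset.card_bij' (fun x _ => (x.1, x.2.1)) (fun q _ => (q.1, q.2, c)) ?_ ?_ ?_ ?_
    · intro x hx
      rw [Finset.mem_filter, mem_QP] at hx
      obtain ⟨⟨hl, ht⟩, hxc, hE⟩ := hx
      rw [Finset.mem_filter, mem_QI]
      refine ⟨⟨?_, ?_⟩, (ERP_mem_iff F₁ F₂ hxc).1 hE⟩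
      · rwa [leakP_core_iff F₁ F₂ (by rw [hxc]; exact hc)] at hl
      · show (x.1, F₁.label x.2.1, F₂.label c) ∈ 𝒯
        have : typP F₁ F₂ x = (x.1, F₁.label x.2.1, F₂.label c) := by simp [typP, hxc]
        rw [← this]; exact ht
    · intro q hq
      rw [Finset.mem_filter, mem_QI] at hq
      obtain ⟨⟨hl, ht⟩, hE⟩ := hq
      rw [Finset.mem_filter, mem_QP]
      refine ⟨⟨?_, ht⟩, rfl, (ERP_mem_iff F₁ F₂ rfl).2 hE⟩
      rw [leakP_core_iff F₁ F₂ hc]; exact hl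
    · intro x hx
      rw [Finset.mem_filter] at hx
      exact Prod.ext rfl (Prod.ext rfl hx.2.1.symm)
    · intro q _
      rfl
  have e2 : ((QP F₁ F₂ 𝒯).filter fun x => x.2.2 = c ∧ EBpreP F₁ F₂ c x ∈ 𝓔).card =
      ((QI F₁ (sliceTP 𝒯 (F₂.label c))).filter fun q => EBI F₁ q ∈ sliceEP F₂ 𝓔 c).card := by
    refine Finset.card_bij' (fun x _ => (x.1, x.2.1)) (fun q _ => (q.1, q.2, c)) ?_ ?_ ?_ ?_
    · intro x hx
      rw [Finset.mem_filter, mem_QP] at hx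
      obtain ⟨⟨hl, ht⟩, hxc, hE⟩ := hx
      rw [Finset.mem_filter, mem_QI]
      refine ⟨⟨?_, ?_⟩, (EBpreP_mem_iff F₁ F₂ c).1 hE⟩
      · rwa [leakP_core_iff F₁ F₂ (by rw [hxc]; exact hc)] at hl
      · show (x.1, F₁.label x.2.1, F₂.label c) ∈ 𝒯
        have : typP F₁ F₂ x = (x.1, F₁.label x.2.1, F₂.label c) := by simp [typP, hxc]
        rw [← this]; exact ht
    · intro q hq
      rw [Finset.mem_filter, mem_QI] at hq
      obtain ⟨⟨hl, ht⟩, hE⟩ := hq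
      rw [Finset.mem_filter, mem_QP]
      refine ⟨⟨?_, ht⟩, rfl, (EBpreP_mem_iff F₁ F₂ c).2 hE⟩
      rw [leakP_core_iff F₁ F₂ hc]; exact hl
    · intro x hx
      rw [Finset.mem_filter] at hx
      exact Prod.ext rfl (Prod.ext rfl hx.2.1.symm)
    · intro q _
      rfl
  rw [e1, e2]
  exact key

/-- A filter on a single point. -/
lemma card_filter_single {α : Type*} [DecidableEq α] (S : Finset α) (a : α) (P : Prop) [Decidable P] :
    (S.filter fun x => x = a ∧ P).card = if a ∈ S ∧ P then 1 else 0 := by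
  by_cases h : a ∈ S ∧ P
  · rw [if_pos h]
    have : (S.filter fun x => x = a ∧ P) = {a} := by
      ext x
      simp only [Finset.mem_filter, Finset.mem_singleton]
      constructor
      · rintro ⟨-, rfl, -⟩; rfl
      · rintro rfl; exact ⟨h.1, rfl, h.2⟩
    rw [this, Finset.card_singleton]
  · rw [if_neg h, Finset.card_eq_zero, Finset.filter_eq_empty_iff]
    rintro x hx ⟨rfl, hP⟩
    exact h ⟨hx, hP⟩

omit [Fintype W₂] in
/-- A point of `coreAll` is core. -/
lemma core_of_mem_coreAll {c : W₂} (hc : c ∈ coreAll F₂.toFibreData) : F₂.core c = true := by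
  rcases Finset.mem_union.1 hc with h | h
  · exact F₂.core0_core c h
  · obtain ⟨c₀, hc₀, rfl⟩ := Finset.mem_image.1 h
    exact F₂.core_flip _ (F₂.core0_core _ hc₀)

omit [Fintype W₂] in
/-- **The pairing over the core of the second component**: the lower core point has the better
label and the smaller atoms. -/
lemma sum_pair_le (P E : W₂ → Prop) (hP : ∀ c ∈ F₂.core0, P (F₂.flip c) → P c)
    (hE : ∀ c ∈ F₂.core0, E c → E (F₂.flip c)) :
    (∑ c ∈ coreAll F₂.toFibreData, if P c ∧ E c then 1 else 0) ≤
      ∑ c ∈ coreAll F₂.toFibreData, if P c ∧ E (F₂.flip c) then 1 else 0 := by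
  have hdisj : Disjoint F₂.core0 (F₂.core0.image F₂.flip) := by
    rw [Finset.disjoint_left]
    intro c hc hc'
    obtain ⟨c₀, hc₀, hcc⟩ := Finset.mem_image.1 hc'
    rw [← hcc] at hc
    exact F₂.flip_core0 c₀ hc₀ hc
  have hinj : Set.InjOn F₂.flip ↑F₂.core0 := fun c _ c' _ h => flip_injective F₂.toFibreData h
  simp only [coreAll, Finset.sum_union hdisj, Finset.sum_image hinj, F₂.flip_flip]
  rw [← Finset.sum_add_distrib, ← Finset.sum_add_distrib]
  refine Finset.sum_le_sum fun c hc => ?_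
  have h1 := hP c hc
  have h2 := hE c hc
  by_cases a : P c <;> by_cases b : P (F₂.flip c) <;> by_cases d : E c <;> by_cases e : E (F₂.flip c) <;>
    simp [a, b, d, e] <;> first | exact absurd (h1 b) a | exact absurd (h2 d) e

/-- **Step 2, the pairing at a fixed point of the first cube**: the frozen blue count is at most
the true one. -/
lemma card_pairP_le {𝒯 : Set (TypP L₁ L₂ ι)} (h𝒯 : IsUpP F₁ F₂ 𝒯) {𝓔 : Set (Set (AtomPr A₁ A₂ ι))}
    (h𝓔 : IsUpperSet 𝓔) (q : PtG W₁ ι) :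
    ((QP F₁ F₂ 𝒯).filter fun x => (x.1, x.2.1) = q ∧ F₂.core x.2.2 = true ∧
        EBpreP F₁ F₂ x.2.2 x ∈ 𝓔).card ≤
      ((QP F₁ F₂ 𝒯).filter fun x => (x.1, x.2.1) = q ∧ F₂.core x.2.2 = true ∧ EBP F₁ F₂ x ∈ 𝓔).card := by
  let P : W₂ → Prop := fun c => (q.1, q.2, c) ∈ QP F₁ F₂ 𝒯
  let E : W₂ → Prop := fun c => EBpreP F₁ F₂ c (q.1, q.2, c) ∈ 𝓔
  -- both sides as sums over the core
  have e1 : ((QP F₁ F₂ 𝒯).filter fun x => (x.1, x.2.1) = q ∧ F₂.core x.2.2 = true ∧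
      EBpreP F₁ F₂ x.2.2 x ∈ 𝓔).card = ∑ c ∈ coreAll F₂.toFibreData, if P c ∧ E c then 1 else 0 := by
    rw [Finset.card_eq_sum_card_fiberwise (f := fun x => x.2.2) (t := coreAll F₂.toFibreData)
      (fun x hx => mem_coreAll_of_core (Finset.mem_filter.1 hx).2.2.1)]
    refine Finset.sum_congr rfl fun c hc => ?_
    rw [Finset.filter_filter]
    have : ((QP F₁ F₂ 𝒯).filter fun x => ((x.1, x.2.1) = q ∧ F₂.core x.2.2 = true ∧
        EBpreP F₁ F₂ x.2.2 x ∈ 𝓔) ∧ x.2.2 = c) =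
        (QP F₁ F₂ 𝒯).filter fun x => x = (q.1, q.2, c) ∧ E c := by
      apply Finset.filter_congr
      intro x hx
      constructor
      · rintro ⟨⟨hq, -, hE⟩, hc⟩
        have hx' : x = (q.1, q.2, c) := by
          rw [← hq, ← hc]
        refine ⟨hx', ?_⟩
        show EBpreP F₁ F₂ c (q.1, q.2, c) ∈ 𝓔
        rw [← hx', ← hc]; exact hE
      · rintro ⟨rfl, hE⟩
        have hcore : F₂.core c = true := core_of_mem_coreAll F₂ hc
        exact ⟨⟨rfl, hcore, hE⟩, rfl⟩
    rw [this, card_filter_single]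
  have e2 : ((QP F₁ F₂ 𝒯).filter fun x => (x.1, x.2.1) = q ∧ F₂.core x.2.2 = true ∧
      EBP F₁ F₂ x ∈ 𝓔).card = ∑ c ∈ coreAll F₂.toFibreData, if P c ∧ E (F₂.flip c) then 1 else 0 := by
    rw [Finset.card_eq_sum_card_fiberwise (f := fun x => x.2.2) (t := coreAll F₂.toFibreData)
      (fun x hx => mem_coreAll_of_core (Finset.mem_filter.1 hx).2.2.1)]
    refine Finset.sum_congr rfl fun c hc => ?_
    rw [Finset.filter_filter]
    have hcore : F₂.core c = true := core_of_mem_coreAll F₂ hc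
    have hEB : EBP F₁ F₂ (q.1, q.2, c) = EBpreP F₁ F₂ (F₂.flip c) (q.1, q.2, F₂.flip c) := by
      rw [EBP_eq_EBpreP]; rfl
    have : ((QP F₁ F₂ 𝒯).filter fun x => ((x.1, x.2.1) = q ∧ F₂.core x.2.2 = true ∧
        EBP F₁ F₂ x ∈ 𝓔) ∧ x.2.2 = c) =
        (QP F₁ F₂ 𝒯).filter fun x => x = (q.1, q.2, c) ∧ E (F₂.flip c) := by
      apply Finset.filter_congr
      intro x _
      constructor
      · rintro ⟨⟨hq, -, hE⟩, hc'⟩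
        have hx' : x = (q.1, q.2, c) := by rw [← hq, ← hc']
        refine ⟨hx', ?_⟩
        show EBpreP F₁ F₂ (F₂.flip c) (q.1, q.2, F₂.flip c) ∈ 𝓔
        rw [← hEB, ← hx']; exact hE
      · rintro ⟨rfl, hE⟩
        refine ⟨⟨rfl, hcore, ?_⟩, rfl⟩
        rw [hEB]
        exact hE
    rw [this, card_filter_single]
  rw [e1, e2]
  have hP : ∀ c ∈ F₂.core0, P (F₂.flip c) → P c := by
    intro c hc h
    have h' : (q.1, q.2, F₂.flip c) ∈ QP F₁ F₂ 𝒯 := h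
    show (q.1, q.2, c) ∈ QP F₁ F₂ 𝒯
    rw [mem_QP] at h' ⊢
    refine ⟨?_, ?_⟩
    · rw [leakP_core_iff F₁ F₂ (F₂.core0_core c hc)]
      rw [leakP_core_iff F₁ F₂ (F₂.core_flip _ (F₂.core0_core c hc))] at h'
      exact h'.1
    · exact h𝒯 _ h'.2 _ ⟨fun _ h => h, F₁.betterL_refl _, F₂.pair_label c hc⟩
  have hE : ∀ c ∈ F₂.core0, E c → E (F₂.flip c) := fun c hc h =>
    h𝓔 (EBpreP_mono F₁ F₂ (F₂.pair_red c hc) _) h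
  convert sum_pair_le F₂ P E hP hE using 3

end Lemmas

end CrossArm

end Summit.Ventures.PercRepro2
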